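import Summits.Parity.GeneralizedHardyLittlewood.Theorems.PrimeLevelFamEdgeMomentsBeyondDiagonalDiagRemDeformedLocalSqf
import Summits.Parity.GeneralizedHardyLittlewood.Theorems.BeyondDiagonalBeatsQuarter.KernelFormXSqLocalSum
import HarnessLib

/-!
# Route `PrimeLevelFamEdge`, crux K_A `MomentsBeyondDiagonal` (stmt-Parity-20007), line «petersson_layers» v4, stub `stub_diag`:
# **the weighted `ℓ¹` bound of the `t`-deformed local factors: `Σ_m |η_n^{(c)}(m)|·m^{1/16} ≤ C_c·D(n)`** (brick D4b of «D4TAIL»)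

With the pointwise bounds of `…DiagRemDeformedLocal` (`|η^{(i)}(k)| ≤ τ(k)³(log k)ⁱ/k` always, `|η^{(j)}(u)| ≤ τ(u)gcd(n,u)(log u)ʲ/u²`
on squarefree `u`, Leibniz splitting over `m = powerfulPart(m)·exactPart(m)`), the argument of `…KernelFormXSqLocalSum` (divisor bound,
`Σ_{k squarefull} k^{−3/4} ≤ 9`, `gcd(n,u) ≤ Σ_{d∣n,d∣u} d`, `Σ_{d∣u} u^{−7/4}`) gives the uniform weighted `ℓ¹` bound, for every `c`:

* `one_add_log_pow_le_mul_rpow` — `(1 + log m)^c ≤ K_c·m^{1/16}` (`m ≥ 1`);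
* `exists_sum_abs_eta_mul_rpow_le` — **`∀ c, ∃ C_c, ∀ n ≥ 1, ∀ N: Σ_{m ≤ N} |η_n^{(c)}(m)|·m^{1/16} ≤ C_c·D(n)`**, `D(n) = Σ_{d∣n}d^{−3/4}`,
  stated for the explicit triple-sum form of `η_n^{(c)}` (`…DiagRemDeformedIdentity.coeff_H`);
* `exists_summable_abs_eta_mul_rpow` — hence summability and the bound for the full series.

Def-free; theorems only. Helper `--supports stmt-Parity-20007`; closes nothing; K_A, K_B and the Parity summit are NOT proved;
nothing about Landau–Siegel zeros.

## References
* E. Kowalski, P. Michel, J. VanderKam, J. reine angew. Math. 526 (2000), Prop. 5.1 p. 18.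
  [cite: KowalskiMichelVanderKam2000, Prop. 5.1 — derivation (absolute convergence of the local factors)]
-/

noncomputable section

open Finset Real ArithmeticFunction

namespace Summit.Parity.GeneralizedHardyLittlewood.Theorems.MomentsBeyondDiagonal.DiagCorner

open Literature.NumberTheory.LFunctions.KMV2000.MollifierMainTerm (W G invA)
open Summit.Parity.GeneralizedHardyLittlewood.Theorems.BeyondDiagonalBeatsQuarter.KernelFormXSq
  (divWeight divWeight_nonneg gcd_le_sum_divisors sum_multiples_rpow_le)
open Literature.NumberTheory.Sieve Literature.NumberTheory.Sieve.PowerfulPart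

/-- `(1 + log m)^c ≤ K_c·m^{1/16}` for all naturals `m ≥ 1`, with `K_c = (1 + 16(c+1))^c`. [folklore] -/
theorem one_add_log_pow_le_mul_rpow (c : ℕ) {m : ℕ} (hm : 1 ≤ m) :
    (1 + Real.log m) ^ c ≤ (1 + 16 * ((c : ℝ) + 1)) ^ c * (m : ℝ) ^ (1 / 16 : ℝ) := by
  have hm1 : (1 : ℝ) ≤ m := by exact_mod_cast hm
  have hm0 : (0 : ℝ) < m := by linarith
  set ε : ℝ := 1 / (16 * ((c : ℝ) + 1)) with hε
  have hε0 : 0 < ε := by positivity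
  have hlog : Real.log m ≤ (m : ℝ) ^ ε / ε := Real.log_natCast_le_rpow_div m hε0
  have hmε : 1 ≤ (m : ℝ) ^ ε := Real.one_le_rpow hm1 hε0.le
  have h1 : 1 + Real.log m ≤ (1 + 1 / ε) * (m : ℝ) ^ ε := by
    rw [add_mul, one_mul, one_div, ← div_eq_inv_mul]
    linarith
  have hlog0 : 0 ≤ 1 + Real.log (m : ℝ) := by linarith [Real.log_nonneg hm1]
  have h1ε : 1 + 1 / ε = 1 + 16 * ((c : ℝ) + 1) := by rw [hε]; field_simp
  calc (1 + Real.log m) ^ c ≤ ((1 + 1 / ε) * (m : ℝ) ^ ε) ^ c := pow_le_pow_left₀ hlog0 h1 c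
    _ = (1 + 16 * ((c : ℝ) + 1)) ^ c * ((m : ℝ) ^ ε) ^ c := by rw [mul_pow, h1ε]
    _ = (1 + 16 * ((c : ℝ) + 1)) ^ c * (m : ℝ) ^ (ε * c) := by rw [← Real.rpow_natCast ((m : ℝ) ^ ε) c, ← Real.rpow_mul hm0.le]
    _ ≤ (1 + 16 * ((c : ℝ) + 1)) ^ c * (m : ℝ) ^ (1 / 16 : ℝ) := by
        refine mul_le_mul_of_nonneg_left (Real.rpow_le_rpow_of_exponent_le hm1 ?_) (by positivity)
        rw [hε]
        have hc0 : (0 : ℝ) ≤ c := Nat.cast_nonneg c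
        rw [div_mul_eq_mul_div, one_mul, div_le_div_iff₀ (by positivity) (by norm_num)]
        nlinarith

set_option maxHeartbeats 1600000 in
/-- **`Σ_{m ≤ N} |η_n^{(c)}(m)|·m^{1/16} ≤ C_c·D(n)`** for all `N` and `n ≥ 1`, with `C_c` depending on `c` only
(`η_n^{(c)}` in the explicit triple-sum form of `…DiagRemDeformedIdentity`). [cite: KowalskiMichelVanderKam2000, Prop. 5.1 — derivation] -/
theorem exists_sum_abs_eta_mul_rpow_le (c : ℕ) :
    ∃ C : ℝ, 0 ≤ C ∧ ∀ n : ℕ, n ≠ 0 → ∀ N : ℕ,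
      ∑ m ∈ Icc 1 N, |∑ y ∈ m.divisorsAntidiagonal, ∑ x ∈ y.1.divisorsAntidiagonal, ∑ z ∈ y.2.divisorsAntidiagonal,
          (x.1 : ℝ)⁻¹ * (x.2 : ℝ)⁻¹ * (if y.2.Coprime n then W y.2 else 0) *
            (Real.log x.1 - Real.log x.2 + (Real.log z.1 - Real.log z.2)) ^ c| * (m : ℝ) ^ (1 / 16 : ℝ) ≤
        C * divWeight n := by
  obtain ⟨C₁, hC₁1, hC₁⟩ := exists_card_divisors_le_mul_rpow (show (0 : ℝ) < 1 / 32 by norm_num)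
  have hC₁0 : 0 ≤ C₁ := by linarith
  set Kc : ℝ := (1 + 16 * ((c : ℝ) + 1)) ^ c with hKc
  have hKc0 : 0 ≤ Kc := by positivity
  set Z : ℝ := ∑' v : ℕ, (v : ℝ) ^ (-(7 / 4 : ℝ)) with hZ
  have hZ0 : 0 ≤ Z := tsum_nonneg fun v ↦ by positivity
  refine ⟨2 ^ c * (9 * (C₁ ^ 3 * Kc)) * (C₁ * Kc * Z), by positivity, fun n hn N ↦ ?_⟩
  -- the deformed objects (to use multiplicativity)
  set AE : ArithmeticFunction (PowerSeries ℝ) :=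
    ⟨fun d ↦ PowerSeries.C ((d : ℝ)⁻¹) * PowerSeries.rescale (1 * Real.log d) (PowerSeries.exp ℝ), by simp⟩ with hAEdef
  set AEm : ArithmeticFunction (PowerSeries ℝ) :=
    ⟨fun d ↦ PowerSeries.C ((d : ℝ)⁻¹) * PowerSeries.rescale (-1 * Real.log d) (PowerSeries.exp ℝ), by simp⟩ with hAEmdef
  set frakA : ArithmeticFunction (PowerSeries ℝ) :=
    ⟨fun k ↦ PowerSeries.C (if k.Coprime n then W k else 0) *
      ∑ z ∈ k.divisorsAntidiagonal, PowerSeries.rescale (1 * Real.log z.1) (PowerSeries.exp ℝ) *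
        PowerSeries.rescale (-1 * Real.log z.2) (PowerSeries.exp ℝ), by simp⟩ with hAdef
  have hAE : ∀ d : ℕ, AE d = PowerSeries.C ((d : ℝ)⁻¹) * PowerSeries.rescale (1 * Real.log d) (PowerSeries.exp ℝ) := fun d ↦ rfl
  have hAEm : ∀ d : ℕ, AEm d = PowerSeries.C ((d : ℝ)⁻¹) * PowerSeries.rescale (-1 * Real.log d) (PowerSeries.exp ℝ) :=
    fun d ↦ rfl
  have hA : ∀ k : ℕ, frakA k = PowerSeries.C (if k.Coprime n then W k else 0) *
      ∑ z ∈ k.divisorsAntidiagonal, PowerSeries.rescale (1 * Real.log z.1) (PowerSeries.exp ℝ) *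
        PowerSeries.rescale (-1 * Real.log z.2) (PowerSeries.exp ℝ) := fun k ↦ rfl
  set H : ArithmeticFunction (PowerSeries ℝ) := AE * AEm * frakA with hHdef
  have hH : H.IsMultiplicative := isMultiplicative_H n AE AEm frakA hAE hAEm hA
  -- `η^{(i)}(m) = i!·[Xⁱ]H(m)`
  have heta : ∀ i m : ℕ, (∑ y ∈ m.divisorsAntidiagonal, ∑ x ∈ y.1.divisorsAntidiagonal, ∑ z ∈ y.2.divisorsAntidiagonal,
      (x.1 : ℝ)⁻¹ * (x.2 : ℝ)⁻¹ * (if y.2.Coprime n then W y.2 else 0) *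
        (Real.log x.1 - Real.log x.2 + (Real.log z.1 - Real.log z.2)) ^ i) =
      (i.factorial : ℝ) * PowerSeries.coeff i (H m) := fun i m ↦ (coeff_H n AE AEm frakA hAE hAEm hA i m).symm
  simp_rw [heta]
  -- the two factors
  set A : ℕ → ℝ := fun m ↦ |(c.factorial : ℝ) * PowerSeries.coeff c (H m)| * (m : ℝ) ^ (1 / 16 : ℝ) with hAdef'
  set A₁ : ℕ → ℝ := fun k ↦ (k.divisors.card : ℝ) ^ 3 * (1 + Real.log k) ^ c / k * (k : ℝ) ^ (1 / 16 : ℝ) with hA₁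
  set A₂ : ℕ → ℝ := fun u ↦ (u.divisors.card : ℝ) * (Nat.gcd n u) * (1 + Real.log u) ^ c / (u : ℝ) ^ 2 *
    (u : ℝ) ^ (1 / 16 : ℝ) with hA₂
  have hA₁0 : ∀ k, 0 ≤ A₁ k := fun k ↦ by
    have : 0 ≤ 1 + Real.log (k : ℝ) := by linarith [Real.log_natCast_nonneg k]
    positivity
  have hA₂0 : ∀ u, 0 ≤ A₂ u := fun u ↦ by
    have : 0 ≤ 1 + Real.log (u : ℝ) := by linarith [Real.log_natCast_nonneg u]
    positivity
  -- `|η^{(i)}(k)| ≤ τ(k)³(1+log k)^c/k` for `i ≤ c`, `k ≥ 1`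
  have hcrude : ∀ i : ℕ, i ≤ c → ∀ k : ℕ, k ≠ 0 →
      |(i.factorial : ℝ) * PowerSeries.coeff i (H k)| ≤ (k.divisors.card : ℝ) ^ 3 * (1 + Real.log k) ^ c / k := by
    intro i hi k hk
    rw [← heta i k]
    refine (abs_eta_le_crude n i hk).trans ?_
    have hl0 : 0 ≤ Real.log (k : ℝ) := Real.log_natCast_nonneg k
    have hk0 : (0 : ℝ) < k := by exact_mod_cast Nat.pos_of_ne_zero hk
    refine div_le_div_of_nonneg_right (mul_le_mul_of_nonneg_left ?_ (by positivity)) hk0.le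
    calc Real.log (k : ℝ) ^ i ≤ (1 + Real.log k) ^ i := pow_le_pow_left₀ hl0 (by linarith) i
      _ ≤ (1 + Real.log k) ^ c := pow_le_pow_right₀ (by linarith) hi
  -- `|η^{(j)}(u)| ≤ τ(u)gcd(n,u)(1+log u)^c/u²` for `j ≤ c`, `u` squarefree
  have hsqf : ∀ j : ℕ, j ≤ c → ∀ u : ℕ, Squarefree u →
      |(j.factorial : ℝ) * PowerSeries.coeff j (H u)| ≤
        (u.divisors.card : ℝ) * (Nat.gcd n u) * (1 + Real.log u) ^ c / (u : ℝ) ^ 2 := by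
    intro j hj u hu
    refine (abs_eta_le_of_squarefree n j AE AEm frakA hAE hAEm hA hu).trans ?_
    have hl0 : 0 ≤ Real.log (u : ℝ) := Real.log_natCast_nonneg u
    refine div_le_div_of_nonneg_right (mul_le_mul_of_nonneg_left ?_ (by positivity)) (by positivity)
    calc Real.log (u : ℝ) ^ j ≤ (1 + Real.log u) ^ j := pow_le_pow_left₀ hl0 (by linarith) j
      _ ≤ (1 + Real.log u) ^ c := pow_le_pow_right₀ (by linarith) hj
  -- factor each term through `m = powerfulPart m · exactPart m`
  have hfac : ∀ m ∈ Icc 1 N, A m ≤ 2 ^ c * (A₁ (powerfulPart m) * A₂ (exactPart m)) := by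
    intro m hm
    have hm0 : m ≠ 0 := by have := (Finset.mem_Icc.1 hm).1; omega
    set k := powerfulPart m with hk
    set u := exactPart m with hu
    have hku : Nat.Coprime k u := coprime_powerfulPart_exactPart m
    have hmku : k * u = m := powerfulPart_mul_exactPart m
    have hk0 : k ≠ 0 := (powerfulPart_pos hm0).ne'
    have husq : Squarefree u := squarefree_exactPart m
    have hsplit := abs_eta_mul_le_of_coprime H hH c hku
    rw [hmku] at hsplit
    have hrpow : (m : ℝ) ^ (1 / 16 : ℝ) = (k : ℝ) ^ (1 / 16 : ℝ) * (u : ℝ) ^ (1 / 16 : ℝ) := by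
      rw [← hmku, Nat.cast_mul, Real.mul_rpow (Nat.cast_nonneg _) (Nat.cast_nonneg _)]
    simp only [hAdef']
    rw [hrpow]
    have hbound : |(c.factorial : ℝ) * PowerSeries.coeff c (H m)| ≤
        2 ^ c * (((k.divisors.card : ℝ) ^ 3 * (1 + Real.log k) ^ c / k) *
          ((u.divisors.card : ℝ) * (Nat.gcd n u) * (1 + Real.log u) ^ c / (u : ℝ) ^ 2)) := by
      refine hsplit.trans ?_
      calc ∑ i ∈ Finset.range (c + 1), (Nat.choose c i : ℝ) *
            (|(i.factorial : ℝ) * PowerSeries.coeff i (H k)| * |((c - i).factorial : ℝ) * PowerSeries.coeff (c - i) (H u)|)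
          ≤ ∑ i ∈ Finset.range (c + 1), (Nat.choose c i : ℝ) *
            (((k.divisors.card : ℝ) ^ 3 * (1 + Real.log k) ^ c / k) *
              ((u.divisors.card : ℝ) * (Nat.gcd n u) * (1 + Real.log u) ^ c / (u : ℝ) ^ 2)) := by
            refine Finset.sum_le_sum fun i hi ↦ mul_le_mul_of_nonneg_left ?_ (Nat.cast_nonneg _)
            have hi' : i ≤ c := Nat.lt_succ_iff.mp (Finset.mem_range.mp hi)
            exact mul_le_mul (hcrude i hi' k hk0) (hsqf (c - i) (by omega) u husq) (abs_nonneg _)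
              (le_trans (abs_nonneg _) (hcrude i hi' k hk0))
        _ = 2 ^ c * _ := by
            rw [← Finset.sum_mul]
            congr 1
            have h := (add_pow (1 : ℝ) 1 c).symm
            simp only [one_pow, mul_one, one_mul] at h
            rw [show (1 : ℝ) + 1 = 2 by norm_num] at h
            rw [← h]
    calc |(c.factorial : ℝ) * PowerSeries.coeff c (H m)| * ((k : ℝ) ^ (1 / 16 : ℝ) * (u : ℝ) ^ (1 / 16 : ℝ))
        ≤ 2 ^ c * (((k.divisors.card : ℝ) ^ 3 * (1 + Real.log k) ^ c / k) *
          ((u.divisors.card : ℝ) * (Nat.gcd n u) * (1 + Real.log u) ^ c / (u : ℝ) ^ 2)) *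
            ((k : ℝ) ^ (1 / 16 : ℝ) * (u : ℝ) ^ (1 / 16 : ℝ)) := mul_le_mul_of_nonneg_right hbound (by positivity)
      _ = 2 ^ c * (A₁ k * A₂ u) := by simp only [hA₁, hA₂]; ring
  -- the two one-dimensional sums
  set K := (Icc 1 N).filter (fun k : ℕ ↦ ∀ p ∈ k.primeFactors, p ^ 2 ∣ k) with hKset
  set U := (Icc 1 N).filter Squarefree with hUset
  have hKsum : ∑ k ∈ K, A₁ k ≤ 9 * (C₁ ^ 3 * Kc) := by
    have hpt : ∀ k ∈ K, A₁ k ≤ (C₁ ^ 3 * Kc) * (k : ℝ) ^ (-(3 / 4 : ℝ)) := by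
      intro k hk
      have hk1 : 1 ≤ k := (Finset.mem_Icc.1 (Finset.mem_filter.1 hk).1).1
      have hk0 : (0 : ℝ) < k := by exact_mod_cast hk1
      have hk1' : (1 : ℝ) ≤ k := by exact_mod_cast hk1
      have hτ := hC₁ k (by omega)
      have hlog := one_add_log_pow_le_mul_rpow c hk1
      simp only [hA₁]
      calc (k.divisors.card : ℝ) ^ 3 * (1 + Real.log k) ^ c / k * (k : ℝ) ^ (1 / 16 : ℝ)
          ≤ (C₁ * (k : ℝ) ^ (1 / 32 : ℝ)) ^ 3 * (Kc * (k : ℝ) ^ (1 / 16 : ℝ)) / k * (k : ℝ) ^ (1 / 16 : ℝ) := by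
            gcongr
        _ = (C₁ ^ 3 * Kc) * ((k : ℝ) ^ (1 / 32 : ℝ) * (k : ℝ) ^ (1 / 32 : ℝ) * (k : ℝ) ^ (1 / 32 : ℝ) *
              (k : ℝ) ^ (1 / 16 : ℝ) * (k : ℝ) ^ (1 / 16 : ℝ) / k) := by ring
        _ = (C₁ ^ 3 * Kc) * (k : ℝ) ^ (-(25 / 32 : ℝ)) := by
            congr 1
            rw [← Real.rpow_add hk0, ← Real.rpow_add hk0, ← Real.rpow_add hk0, ← Real.rpow_add hk0,
              div_eq_mul_inv, ← Real.rpow_neg_one, ← Real.rpow_add hk0]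
            norm_num
        _ ≤ (C₁ ^ 3 * Kc) * (k : ℝ) ^ (-(3 / 4 : ℝ)) := by
            refine mul_le_mul_of_nonneg_left (Real.rpow_le_rpow_of_exponent_le hk1' (by norm_num)) (by positivity)
    refine (Finset.sum_le_sum hpt).trans ?_
    rw [← Finset.mul_sum]
    rw [mul_comm]
    refine mul_le_mul_of_nonneg_right ?_ (by positivity)
    calc ∑ k ∈ K, (k : ℝ) ^ (-(3 / 4 : ℝ))
        ≤ ∑ a ∈ Icc 1 N, ∑ b ∈ Icc 1 N, (((a ^ 2 * b ^ 3 : ℕ) : ℝ)) ^ (-(3 / 4 : ℝ)) :=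
          sum_filter_squarefull_le N fun k ↦ by positivity
      _ ≤ ∑ a ∈ Icc 1 N, ∑ b ∈ Icc 1 N, 1 / (((a : ℝ) * Real.sqrt a) * ((b : ℝ) * Real.sqrt b)) := by
          refine Finset.sum_le_sum fun a ha ↦ Finset.sum_le_sum fun b hb ↦ ?_
          exact rpow_neg_three_quarters_le (Finset.mem_Icc.1 ha).1 (Finset.mem_Icc.1 hb).1
      _ ≤ 9 := sum_box_le_nine N
  have hDW : divWeight n = ∑ d ∈ n.divisors, (d : ℝ) ^ (-(3 / 4 : ℝ)) := rfl
  have hUsum : ∑ u ∈ U, A₂ u ≤ (C₁ * Kc * Z) * divWeight n := by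
    rw [hDW]
    have hpt : ∀ u ∈ U, A₂ u ≤ (C₁ * Kc) * ((Nat.gcd n u : ℝ) * (u : ℝ) ^ (-(7 / 4 : ℝ))) := by
      intro u hu
      have hu' := Finset.mem_filter.1 hu
      have hu1 : 1 ≤ u := (Finset.mem_Icc.1 hu'.1).1
      have hu0 : (0 : ℝ) < u := by exact_mod_cast hu1
      have hu1' : (1 : ℝ) ≤ u := by exact_mod_cast hu1
      have hτ := hC₁ u (by omega)
      have hlog := one_add_log_pow_le_mul_rpow c hu1
      have hg0 : (0 : ℝ) ≤ Nat.gcd n u := Nat.cast_nonneg _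
      simp only [hA₂]
      calc (u.divisors.card : ℝ) * (Nat.gcd n u) * (1 + Real.log u) ^ c / (u : ℝ) ^ 2 * (u : ℝ) ^ (1 / 16 : ℝ)
          ≤ (C₁ * (u : ℝ) ^ (1 / 32 : ℝ)) * (Nat.gcd n u) * (Kc * (u : ℝ) ^ (1 / 16 : ℝ)) / (u : ℝ) ^ 2 *
              (u : ℝ) ^ (1 / 16 : ℝ) := by gcongr
        _ = (C₁ * Kc) * ((Nat.gcd n u : ℝ) * ((u : ℝ) ^ (1 / 32 : ℝ) * (u : ℝ) ^ (1 / 16 : ℝ) *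
              (u : ℝ) ^ (1 / 16 : ℝ) / (u : ℝ) ^ 2)) := by ring
        _ = (C₁ * Kc) * ((Nat.gcd n u : ℝ) * (u : ℝ) ^ (-(59 / 32 : ℝ))) := by
            congr 2
            rw [← Real.rpow_add hu0, ← Real.rpow_add hu0, show ((u : ℝ) ^ (2 : ℕ)) = (u : ℝ) ^ (2 : ℝ) by
              rw [← Real.rpow_natCast]; norm_num, div_eq_mul_inv, ← Real.rpow_neg hu0.le, ← Real.rpow_add hu0]
            norm_num
        _ ≤ (C₁ * Kc) * ((Nat.gcd n u : ℝ) * (u : ℝ) ^ (-(7 / 4 : ℝ))) := by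
            refine mul_le_mul_of_nonneg_left (mul_le_mul_of_nonneg_left
              (Real.rpow_le_rpow_of_exponent_le hu1' (by norm_num)) hg0) (by positivity)
    refine (Finset.sum_le_sum hpt).trans ?_
    rw [← Finset.mul_sum, show C₁ * Kc * Z * ∑ d ∈ n.divisors, (d : ℝ) ^ (-(3 / 4 : ℝ)) =
      (C₁ * Kc) * (Z * ∑ d ∈ n.divisors, (d : ℝ) ^ (-(3 / 4 : ℝ))) by ring]
    refine mul_le_mul_of_nonneg_left ?_ (by positivity)
    -- `gcd(n,u) ≤ Σ_{d | n, d | u} d`, then exchange (verbatim from `…KernelFormXSqLocalSum`)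
    have hstep : ∑ u ∈ U, (Nat.gcd n u : ℝ) * (u : ℝ) ^ (-(7 / 4 : ℝ)) ≤
        ∑ u ∈ U, ∑ d ∈ n.divisors, (if d ∣ u then (d : ℝ) * (u : ℝ) ^ (-(7 / 4 : ℝ)) else 0) := by
      refine Finset.sum_le_sum fun u _ ↦ ?_
      rw [← Finset.sum_filter, ← Finset.sum_mul]
      exact mul_le_mul_of_nonneg_right (gcd_le_sum_divisors hn u) (by positivity)
    refine hstep.trans ?_
    rw [Finset.sum_comm, Finset.mul_sum]
    refine Finset.sum_le_sum fun d hd ↦ ?_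
    have hd0 : d ≠ 0 := Nat.pos_iff_ne_zero.1 (Nat.pos_of_mem_divisors hd)
    have hd0' : (0 : ℝ) < d := by exact_mod_cast Nat.pos_of_ne_zero hd0
    rw [← Finset.sum_filter]
    calc ∑ u ∈ U.filter (fun u ↦ d ∣ u), (d : ℝ) * (u : ℝ) ^ (-(7 / 4 : ℝ))
        = (d : ℝ) * ∑ u ∈ U.filter (fun u ↦ d ∣ u), (u : ℝ) ^ (-(7 / 4 : ℝ)) := by rw [Finset.mul_sum]
      _ ≤ (d : ℝ) * ∑ u ∈ (Icc 1 N).filter (fun u ↦ d ∣ u), (u : ℝ) ^ (-(7 / 4 : ℝ)) := by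
          refine mul_le_mul_of_nonneg_left ?_ hd0'.le
          refine Finset.sum_le_sum_of_subset_of_nonneg ?_ fun u _ _ ↦ by positivity
          intro u hu
          simp only [hUset, Finset.mem_filter] at hu ⊢
          exact ⟨hu.1.1, hu.2⟩
      _ ≤ (d : ℝ) * ((d : ℝ) ^ (-(7 / 4 : ℝ)) * Z) :=
          mul_le_mul_of_nonneg_left (sum_multiples_rpow_le hd0 N) hd0'.le
      _ = Z * (d : ℝ) ^ (-(3 / 4 : ℝ)) := by
          rw [show (-(3 / 4 : ℝ)) = 1 + (-(7 / 4 : ℝ)) by norm_num, Real.rpow_add hd0', Real.rpow_one]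
          ring
  -- assembly through the injection `m ↦ (powerfulPart m, exactPart m)`
  have hD0 : 0 ≤ divWeight n := divWeight_nonneg n
  set φ : ℕ → ℕ × ℕ := fun m ↦ (powerfulPart m, exactPart m) with hφ
  have hinj : Set.InjOn φ (Icc 1 N : Finset ℕ) := by
    intro m _ m' _ h
    simp only [hφ, Prod.mk.injEq] at h
    rw [← powerfulPart_mul_exactPart m, ← powerfulPart_mul_exactPart m', h.1, h.2]
  have himg : (Icc 1 N).image φ ⊆ K ×ˢ U := by
    intro q hq
    obtain ⟨m, hm, rfl⟩ := Finset.mem_image.1 hq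
    have hm' := Finset.mem_Icc.1 hm
    have hm0 : m ≠ 0 := by omega
    simp only [hφ, Finset.mem_product, hKset, hUset, Finset.mem_filter, Finset.mem_Icc]
    refine ⟨⟨⟨powerfulPart_pos hm0, (Nat.le_of_dvd (by omega) (powerfulPart_dvd m)).trans hm'.2⟩,
      fun p hp ↦ sq_dvd_powerfulPart_of_dvd (Nat.prime_of_mem_primeFactors hp)
        (Nat.dvd_of_mem_primeFactors hp)⟩,
      ⟨exactPart_pos m, (Nat.le_of_dvd (by omega) (exactPart_dvd m)).trans hm'.2⟩,
      squarefree_exactPart m⟩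
  calc ∑ m ∈ Icc 1 N, A m ≤ ∑ m ∈ Icc 1 N, 2 ^ c * (A₁ (φ m).1 * A₂ (φ m).2) := Finset.sum_le_sum hfac
    _ = 2 ^ c * ∑ m ∈ Icc 1 N, A₁ (φ m).1 * A₂ (φ m).2 := by rw [Finset.mul_sum]
    _ = 2 ^ c * ∑ q ∈ (Icc 1 N).image φ, A₁ q.1 * A₂ q.2 := by rw [Finset.sum_image hinj]
    _ ≤ 2 ^ c * ∑ q ∈ K ×ˢ U, A₁ q.1 * A₂ q.2 := by
        refine mul_le_mul_of_nonneg_left ?_ (by positivity)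
        exact Finset.sum_le_sum_of_subset_of_nonneg himg fun q _ _ ↦ mul_nonneg (hA₁0 _) (hA₂0 _)
    _ = 2 ^ c * ((∑ k ∈ K, A₁ k) * ∑ u ∈ U, A₂ u) := by rw [Finset.sum_product, Finset.sum_mul_sum]
    _ ≤ 2 ^ c * ((9 * (C₁ ^ 3 * Kc)) * ((C₁ * Kc * Z) * divWeight n)) := by
        refine mul_le_mul_of_nonneg_left ?_ (by positivity)
        exact mul_le_mul hKsum hUsum (Finset.sum_nonneg fun u _ ↦ hA₂0 u) (by positivity)
    _ = 2 ^ c * (9 * (C₁ ^ 3 * Kc)) * (C₁ * Kc * Z) * divWeight n := by ring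

/-- **Summability and the bound for the full series `Σ_m |η_n^{(c)}(m)|·m^{1/16} ≤ C_c·D(n)`** (`n ≥ 1`).
[cite: KowalskiMichelVanderKam2000, Prop. 5.1 — derivation (absolute convergence of the local factors)] -/
theorem exists_summable_abs_eta_mul_rpow (c : ℕ) :
    ∃ C : ℝ, 0 ≤ C ∧ ∀ n : ℕ, n ≠ 0 →
      (Summable fun m : ℕ ↦ |∑ y ∈ m.divisorsAntidiagonal, ∑ x ∈ y.1.divisorsAntidiagonal, ∑ z ∈ y.2.divisorsAntidiagonal,
          (x.1 : ℝ)⁻¹ * (x.2 : ℝ)⁻¹ * (if y.2.Coprime n then W y.2 else 0) *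
            (Real.log x.1 - Real.log x.2 + (Real.log z.1 - Real.log z.2)) ^ c| * (m : ℝ) ^ (1 / 16 : ℝ)) ∧
      (∑' m : ℕ, |∑ y ∈ m.divisorsAntidiagonal, ∑ x ∈ y.1.divisorsAntidiagonal, ∑ z ∈ y.2.divisorsAntidiagonal,
          (x.1 : ℝ)⁻¹ * (x.2 : ℝ)⁻¹ * (if y.2.Coprime n then W y.2 else 0) *
            (Real.log x.1 - Real.log x.2 + (Real.log z.1 - Real.log z.2)) ^ c| * (m : ℝ) ^ (1 / 16 : ℝ)) ≤
        C * divWeight n := by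
  obtain ⟨C, hC, h⟩ := exists_sum_abs_eta_mul_rpow_le c
  refine ⟨C, hC, fun n hn ↦ ?_⟩
  set f : ℕ → ℝ := fun m ↦ |∑ y ∈ m.divisorsAntidiagonal, ∑ x ∈ y.1.divisorsAntidiagonal,
      ∑ z ∈ y.2.divisorsAntidiagonal,
        (x.1 : ℝ)⁻¹ * (x.2 : ℝ)⁻¹ * (if y.2.Coprime n then W y.2 else 0) *
          (Real.log x.1 - Real.log x.2 + (Real.log z.1 - Real.log z.2)) ^ c| * (m : ℝ) ^ (1 / 16 : ℝ) with hf
  have hf0 : ∀ m, 0 ≤ f m := fun m ↦ by positivity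
  have hrange : ∀ M : ℕ, ∑ m ∈ Finset.range M, f m ≤ C * divWeight n := by
    intro M
    have hsub : Finset.range M ⊆ insert 0 (Icc 1 M) := by
      intro m hm
      simp only [Finset.mem_range] at hm
      simp only [Finset.mem_insert, Finset.mem_Icc]
      omega
    calc ∑ m ∈ Finset.range M, f m ≤ ∑ m ∈ insert 0 (Icc 1 M), f m :=
          Finset.sum_le_sum_of_subset_of_nonneg hsub fun m _ _ ↦ hf0 m
      _ = ∑ m ∈ Icc 1 M, f m := by
          rw [Finset.sum_insert (by simp)]
          simp [hf]
      _ ≤ C * divWeight n := h n hn M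
  have hsum : Summable f := summable_of_sum_range_le hf0 hrange
  exact ⟨hsum, hsum.tsum_le_of_sum_range_le hrange⟩

end Summit.Parity.GeneralizedHardyLittlewood.Theorems.MomentsBeyondDiagonal.DiagCorner

end
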